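import Summits.KontsevichZagierPeriods.Zeta5Search.Barrier.ConeGammaCuspSlopeLipschitz

/-!
# ζ(5) search — BARRIER: a SIMPLE CROSSING of the translated orbit — frozen floors, the one moving floor, the jump,
# and the exact window integral (local half of «the signed jump masses are the gradient of the translate integral»)

HONEST FRAMING (cell `pub-zeta5`): systematic search; no irrationality claim unless kernel-certified. MODEL objects
under Brown–Zudilin's (28)+(30) accounting ([BZ22] = arXiv:2210.03391; (28) observed, not proved); nothing here is a
statement about `ζ(5)`, any `γ` of record, the cone's supremum (C2 OPEN) or the value / sign of any jump at a named
direction (DATA of the cell); S-E / (TD_A) stay CONJECTURED; records in print UNMOVED. Prover P2 g40 (item «THE SIGNED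
JUMP MASSES», file (2a); plan INBOX 2026-08-28 l.9814).

Along the orbit of a direction `a` (all 28 forms `h_k(a) > 0`) translated by `δ`, `u ↦ θ_u := u·s(a) + δ`, the form
`k` takes the value `u·h_k(a) + φ_k(δ)` and crosses the integer `z` at the CROSSING TIME `s_{k,z} = (z − φ_k δ)/h_k(a)`
(written out everywhere; no definition). A margin `r > 0` SEPARATES the crossing `(k₀, z₀)` if every other crossing time
of every form is at least `r` away from `s₀ = s_{k₀,z₀}` (hypothesis shape `hsep` below — for a concrete translate this is
finitely many rational inequalities, certificate-style). Then, on the closed window `|u − s₀| ≤ r/2` and for every further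
displacement `Δ'` with `|φ_k(Δ')| ≤ r·h_k(a)/4`:
* `floor_line_eq_of_far`, `floor_line_crossing` — the 27 floors `k ≠ k₀` of `θ_u + Δ'` are FROZEN at their values at
  `s₀`, and the floor of `k₀` is `z₀ − 1` or `z₀`;
* `torusN_congr_phiForm` (`𝒩` is a function of the 28 floors), **`torusN_near_crossing`** — hence
  **`𝒩(θ_u + Δ') = 𝒩(θ_{s₀ − r/2}) + (⌊u·h_{k₀} + φ_{k₀}δ + φ_{k₀}Δ'⌋ − (z₀ − 1))·J`** with the JUMP
  **`J = 𝒩(θ_{s₀}) − 𝒩(θ_{s₀ − r/2})`** of the crossing; **`jump_mem_of_FIdx` / `jump_mem_of_not_FIdx`** — `J ∈ {0, 1}`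
  for `k₀ ∈ F`, `J ∈ {−1, 0}` for `k₀ ∉ F` (P2 g26's wall orientation `torusN_floor_step`);
* **`torusN_sub_near_crossing`** — so the response to `Δ` on the window is `J·(⌊y + φ_{k₀}Δ⌋ − ⌊y⌋)`,
  `y = u·h_{k₀} + φ_{k₀}δ`; `torusN_add_eq_of_far` — and it is `0` at every `u` at distance `≥ r/2` from all crossings;
* `integral_floor_shift_window`, **`integral_floor_line_shift_window`** — the EXACT window integral
  `∫_{s₀−ρ}^{s₀+ρ} (⌊u·x + c + e⌋ − ⌊u·x + c⌋) du = e/x` (`s₀·x + c ∈ ℤ`, `|e| < ρx ≤ 1/2`): a crossing displaced by `e`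
  in form value moves by `e/x` in time and carries its jump with it.
File (2b) `ConeGammaTranslateGradient` sums these over the `T·h_k(a)` crossings of one period (file (1) of the item,
`ConeGammaTermEquidistribution`, is logically independent of files (2a)–(4)). NOT here (honest): any value
at a named direction; anything about `Φ`, `γ`, C2, S-E, `ζ(5)`.
-/

noncomputable section

open Set MeasureTheory
open scoped Topology

namespace Summit.KontsevichZagierPeriods.Zeta5Search.Barrier.ConeGamma

/-! ### One floor along a line: frozen away from its crossings, a unit step at a crossing -/

/-- **Frozen floor.** If every crossing time `(z − c)/x` of the value `u·x + c` (`x > 0`) is at distance `≥ ρ` from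
`s₀`, then `⌊(s₀ + t)·x + c + e⌋ = ⌊s₀·x + c⌋` whenever `|t|·x + |e| < ρ·x`. -/
theorem floor_line_eq_of_far {x c s₀ ρ : ℝ} (hx : 0 < x) (hfar : ∀ z : ℤ, ρ ≤ |s₀ - ((z : ℝ) - c) / x|)
    {t e : ℝ} (hte : |t| * x + |e| < ρ * x) : ⌊(s₀ + t) * x + c + e⌋ = ⌊s₀ * x + c⌋ := by
  set y₀ := s₀ * x + c with hy₀
  have hdist : ∀ z : ℤ, ρ * x ≤ |y₀ - z| := by
    intro z
    have h := mul_le_mul_of_nonneg_right (hfar z) hx.le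
    rw [← abs_of_pos hx, ← abs_mul, abs_of_pos hx] at h
    have e : (s₀ - ((z : ℝ) - c) / x) * x = y₀ - z := by rw [hy₀]; field_simp; ring
    rwa [e] at h
  have h1 : ρ * x ≤ y₀ - ⌊y₀⌋ := by
    have h := hdist ⌊y₀⌋
    rwa [abs_of_nonneg (by linarith [Int.floor_le y₀])] at h
  have h2 : ρ * x ≤ ⌊y₀⌋ + 1 - y₀ := by
    have h := hdist (⌊y₀⌋ + 1)
    push_cast at h
    rw [abs_of_nonpos (by linarith [Int.lt_floor_add_one y₀])] at h
    linarith
  have hp : |t * x + e| < min (y₀ - ⌊y₀⌋) (⌊y₀⌋ + 1 - y₀) := by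
    refine lt_min ?_ ?_
    · calc |t * x + e| ≤ |t| * x + |e| := by
            calc |t * x + e| ≤ |t * x| + |e| := abs_add_le _ _
              _ = |t| * x + |e| := by rw [abs_mul, abs_of_pos hx]
        _ < ρ * x := hte
        _ ≤ _ := h1
    · calc |t * x + e| ≤ |t| * x + |e| := by
            calc |t * x + e| ≤ |t * x| + |e| := abs_add_le _ _
              _ = |t| * x + |e| := by rw [abs_mul, abs_of_pos hx]
        _ < ρ * x := hte
        _ ≤ _ := h2
  rw [show (s₀ + t) * x + c + e = y₀ + (t * x + e) by rw [hy₀]; ring]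
  exact floor_add_eq_of_small hp

/-- **The moving floor at a crossing.** If `s₀·x + c = z₀ ∈ ℤ` and `|t|·x + |e| < 1`, then
`⌊(s₀ + t)·x + c + e⌋ = z₀ + ⌊t·x + e⌋` with `⌊t·x + e⌋ ∈ {−1, 0}`. -/
theorem floor_line_crossing {x c s₀ : ℝ} {z₀ : ℤ} (hx : 0 < x) (hs₀ : s₀ * x + c = z₀) {t e : ℝ}
    (hte : |t| * x + |e| < 1) :
    ⌊(s₀ + t) * x + c + e⌋ = z₀ + ⌊t * x + e⌋ ∧ (⌊t * x + e⌋ = -1 ∨ ⌊t * x + e⌋ = 0) := by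
  have hsmall : |t * x + e| < 1 :=
    calc |t * x + e| ≤ |t * x| + |e| := abs_add_le _ _
      _ = |t| * x + |e| := by rw [abs_mul, abs_of_pos hx]
      _ < 1 := hte
  refine ⟨?_, ?_⟩
  · rw [show (s₀ + t) * x + c + e = (z₀ : ℝ) + (t * x + e) by rw [← hs₀]; ring, Int.floor_intCast_add]
  · have h := abs_lt.mp hsmall
    rcases lt_or_ge (t * x + e) 0 with hneg | hnn
    · left; rw [Int.floor_eq_iff]; push_cast; constructor <;> linarith
    · right; rw [Int.floor_eq_iff]; push_cast; constructor <;> linarith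

/-! ### `𝒩` is a function of the 28 floors -/

/-- **`𝒩` is a function of the 28 floors** (form-indexed version of `torusN_congr_floor`). -/
theorem torusN_congr_phiForm {θ θ' : Fin 8 → ℝ} (h : ∀ k : Fin 28, ⌊phiForm θ k⌋ = ⌊phiForm θ' k⌋) :
    torusN θ = torusN θ' := by
  refine torusN_congr_floor fun i j hij => ?_
  rcases lt_or_gt_of_ne hij with hlt | hgt
  · rw [pairForm_eq_phiForm_idxOf θ hlt, pairForm_eq_phiForm_idxOf θ' hlt]; exact h _
  · rw [pairForm_comm θ, pairForm_comm θ', pairForm_eq_phiForm_idxOf θ hgt, pairForm_eq_phiForm_idxOf θ' hgt]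
    exact h _

/-! ### A separated simple crossing: the floors on the window -/

/-- **Frozen floors of the other 27 forms.** All forms of `a` positive; the crossing `(k₀, z₀)` at
`s₀ = (z₀ − φ_{k₀}δ)/h_{k₀}` separated by `r` from every crossing of every other form; `|u − s₀| ≤ r/2`;
`|φ_k Δ'| ≤ r·h_k/4` for all `k`. Then for `k ≠ k₀`: `⌊φ_k(u·s(a) + δ + Δ')⌋ = ⌊s₀·h_k + φ_k δ⌋`. -/
theorem floor_other_near_crossing {a : Dir} (hpos : ∀ k, 0 < h28 a k) {δ : Fin 8 → ℝ} {r : ℝ} (hr : 0 < r)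
    {k₀ : Fin 28} {z₀ : ℤ}
    (hsep : ∀ (k : Fin 28) (z : ℤ), k ≠ k₀ →
      r ≤ |((z₀ : ℝ) - phiForm δ k₀) / h28 a k₀ - ((z : ℝ) - phiForm δ k) / h28 a k|)
    {u : ℝ} (hu : |u - ((z₀ : ℝ) - phiForm δ k₀) / h28 a k₀| ≤ r / 2)
    {Δ' : Fin 8 → ℝ} (hΔ' : ∀ k, |phiForm Δ' k| ≤ r * h28 a k / 4) {k : Fin 28} (hk : k ≠ k₀) :
    ⌊phiForm (u • sParam a + δ + Δ') k⌋ = ⌊((z₀ : ℝ) - phiForm δ k₀) / h28 a k₀ * h28 a k + phiForm δ k⌋ := by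
  set s₀ := ((z₀ : ℝ) - phiForm δ k₀) / h28 a k₀
  have hxk := hpos k
  rw [phiForm_line_add, show u = s₀ + (u - s₀) by ring]
  refine floor_line_eq_of_far hxk (fun z => hsep k z hk) ?_
  calc |u - s₀| * h28 a k + |phiForm Δ' k| ≤ r / 2 * h28 a k + r * h28 a k / 4 :=
        add_le_add (mul_le_mul_of_nonneg_right hu hxk.le) (hΔ' k)
    _ < r * h28 a k := by nlinarith

/-- **The floor of the crossing form** on the window: `⌊φ_{k₀}(u·s(a) + δ + Δ')⌋ ∈ {z₀ − 1, z₀}` (with `r·h_{k₀} ≤ 1`). -/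
theorem floor_self_near_crossing {a : Dir} (hpos : ∀ k, 0 < h28 a k) {δ : Fin 8 → ℝ} {r : ℝ}
    {k₀ : Fin 28} {z₀ : ℤ} (hr1 : r * h28 a k₀ ≤ 1)
    {u : ℝ} (hu : |u - ((z₀ : ℝ) - phiForm δ k₀) / h28 a k₀| ≤ r / 2)
    {Δ' : Fin 8 → ℝ} (hΔ' : ∀ k, |phiForm Δ' k| ≤ r * h28 a k / 4) :
    ⌊phiForm (u • sParam a + δ + Δ') k₀⌋ = z₀ - 1 ∨ ⌊phiForm (u • sParam a + δ + Δ') k₀⌋ = z₀ := by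
  set s₀ := ((z₀ : ℝ) - phiForm δ k₀) / h28 a k₀ with hs₀def
  have hx := hpos k₀
  have hs₀ : s₀ * h28 a k₀ + phiForm δ k₀ = z₀ := by rw [hs₀def, div_mul_cancel₀ _ hx.ne']; ring
  rw [phiForm_line_add, show u = s₀ + (u - s₀) by ring]
  have hte : |u - s₀| * h28 a k₀ + |phiForm Δ' k₀| < 1 := by
    calc |u - s₀| * h28 a k₀ + |phiForm Δ' k₀| ≤ r / 2 * h28 a k₀ + r * h28 a k₀ / 4 :=
          add_le_add (mul_le_mul_of_nonneg_right hu hx.le) (hΔ' k₀)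
      _ < 1 := by nlinarith
  obtain ⟨h1, h2 | h2⟩ := floor_line_crossing hx hs₀ hte
  · left; rw [h1, h2]; ring
  · right; rw [h1, h2]; ring

/-- The two REPRESENTATIVE points of the crossing: at `s₀` the crossing form has floor `z₀`, at `s₀ − r/2` it has floor
`z₀ − 1` (`0 < r·h_{k₀} ≤ 1`). -/
theorem floor_self_at_crossing {a : Dir} (hpos : ∀ k, 0 < h28 a k) (δ : Fin 8 → ℝ) {r : ℝ} (hr : 0 < r)
    (k₀ : Fin 28) (z₀ : ℤ) (hr1 : r * h28 a k₀ ≤ 1) :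
    ⌊phiForm ((((z₀ : ℝ) - phiForm δ k₀) / h28 a k₀) • sParam a + δ) k₀⌋ = z₀ ∧
    ⌊phiForm ((((z₀ : ℝ) - phiForm δ k₀) / h28 a k₀ - r / 2) • sParam a + δ) k₀⌋ = z₀ - 1 := by
  have hx := hpos k₀
  have hs₀ : ((z₀ : ℝ) - phiForm δ k₀) / h28 a k₀ * h28 a k₀ + phiForm δ k₀ = z₀ := by
    rw [div_mul_cancel₀ _ hx.ne']; ring
  constructor
  · rw [phiForm_line, hs₀, Int.floor_intCast]
  · rw [phiForm_line, show (((z₀ : ℝ) - phiForm δ k₀) / h28 a k₀ - r / 2) * h28 a k₀ + phiForm δ k₀ =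
      (z₀ : ℝ) + (-(r / 2 * h28 a k₀)) by rw [sub_mul, div_mul_cancel₀ _ hx.ne']; ring, Int.floor_intCast_add]
    have : ⌊-(r / 2 * h28 a k₀)⌋ = -1 := by
      rw [Int.floor_eq_iff]; push_cast; constructor <;> nlinarith
    rw [this]; ring

/-! ### The value of the saving on the window, and the jump -/

/-- **THE SAVING NEAR A SEPARATED SIMPLE CROSSING.** All 28 forms of `a` positive; the crossing `(k₀, z₀)` of the
translate `δ` at `s₀ = (z₀ − φ_{k₀}δ)/h_{k₀}(a)`, separated by `r > 0` (`r·h_{k₀} ≤ 1`) from every crossing of every other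
form. Then for `|u − s₀| ≤ r/2` and every `Δ'` with `|φ_k Δ'| ≤ r·h_k/4`:
`𝒩(u·s(a) + δ + Δ') = 𝒩(θ_{s₀ − r/2}) + (⌊u·h_{k₀} + φ_{k₀}δ + φ_{k₀}Δ'⌋ − (z₀ − 1))·J`, `J = 𝒩(θ_{s₀}) − 𝒩(θ_{s₀ − r/2})`,
`θ_v = v·s(a) + δ` — and the bracket is `0` or `1`. -/
theorem torusN_near_crossing {a : Dir} (hpos : ∀ k, 0 < h28 a k) {δ : Fin 8 → ℝ} {r : ℝ} (hr : 0 < r)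
    {k₀ : Fin 28} {z₀ : ℤ} (hr1 : r * h28 a k₀ ≤ 1)
    (hsep : ∀ (k : Fin 28) (z : ℤ), k ≠ k₀ →
      r ≤ |((z₀ : ℝ) - phiForm δ k₀) / h28 a k₀ - ((z : ℝ) - phiForm δ k) / h28 a k|)
    {u : ℝ} (hu : |u - ((z₀ : ℝ) - phiForm δ k₀) / h28 a k₀| ≤ r / 2)
    {Δ' : Fin 8 → ℝ} (hΔ' : ∀ k, |phiForm Δ' k| ≤ r * h28 a k / 4) :
    (torusN (u • sParam a + δ + Δ') : ℤ) =
      torusN ((((z₀ : ℝ) - phiForm δ k₀) / h28 a k₀ - r / 2) • sParam a + δ) +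
        (⌊u * h28 a k₀ + phiForm δ k₀ + phiForm Δ' k₀⌋ - (z₀ - 1)) *
          (torusN ((((z₀ : ℝ) - phiForm δ k₀) / h28 a k₀) • sParam a + δ) -
            torusN ((((z₀ : ℝ) - phiForm δ k₀) / h28 a k₀ - r / 2) • sParam a + δ)) ∧
    (⌊u * h28 a k₀ + phiForm δ k₀ + phiForm Δ' k₀⌋ - (z₀ - 1) = 0 ∨
      ⌊u * h28 a k₀ + phiForm δ k₀ + phiForm Δ' k₀⌋ - (z₀ - 1) = 1) := by
  set s₀ := ((z₀ : ℝ) - phiForm δ k₀) / h28 a k₀ with hs₀def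
  have h0 : ∀ k, |phiForm (0 : Fin 8 → ℝ) k| ≤ r * h28 a k / 4 := fun k => by
    have : phiForm (0 : Fin 8 → ℝ) k = 0 := by
      have h := phiForm_smul 0 (0 : Fin 8 → ℝ) k; rwa [zero_smul, zero_mul] at h
    rw [this, abs_zero]; have := hpos k; positivity
  -- the two representative points, as `u•s(a) + δ + 0` with `u = s₀`, `s₀ - r/2`
  have huP : |s₀ - s₀| ≤ r / 2 := by rw [sub_self, abs_zero]; positivity
  have huM : |s₀ - r / 2 - s₀| ≤ r / 2 := by
    rw [show s₀ - r / 2 - s₀ = -(r / 2) by ring, abs_neg, abs_of_pos (by positivity)]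
  obtain ⟨hkP, hkM⟩ := floor_self_at_crossing hpos δ hr k₀ z₀ hr1
  -- floors of the other forms: all equal to the frozen value
  have hother : ∀ k, k ≠ k₀ → ⌊phiForm (u • sParam a + δ + Δ') k⌋ = ⌊s₀ * h28 a k + phiForm δ k⌋ :=
    fun k hk => floor_other_near_crossing hpos hr hsep hu hΔ' hk
  have hotherP : ∀ k, k ≠ k₀ → ⌊phiForm (s₀ • sParam a + δ) k⌋ = ⌊s₀ * h28 a k + phiForm δ k⌋ := fun k hk => by
    have h := floor_other_near_crossing hpos hr hsep huP h0 hk; rwa [add_zero] at h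
  have hotherM : ∀ k, k ≠ k₀ → ⌊phiForm ((s₀ - r / 2) • sParam a + δ) k⌋ = ⌊s₀ * h28 a k + phiForm δ k⌋ :=
    fun k hk => by have h := floor_other_near_crossing hpos hr hsep huM h0 hk; rwa [add_zero] at h
  have hself := floor_self_near_crossing hpos hr1 hu hΔ'
  rw [phiForm_line_add] at hself
  rcases hself with h | h
  · -- floor `z₀ - 1`: the point has the floors of `θ_{s₀ - r/2}`
    have hN : torusN (u • sParam a + δ + Δ') = torusN ((s₀ - r / 2) • sParam a + δ) := by
      refine torusN_congr_phiForm fun k => ?_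
      by_cases hk : k = k₀
      · subst hk; rw [phiForm_line_add, h, hkM]
      · rw [hother k hk, hotherM k hk]
    refine ⟨?_, Or.inl (by rw [h]; ring)⟩
    rw [hN, h]; ring
  · -- floor `z₀`: the point has the floors of `θ_{s₀}`
    have hN : torusN (u • sParam a + δ + Δ') = torusN (s₀ • sParam a + δ) := by
      refine torusN_congr_phiForm fun k => ?_
      by_cases hk : k = k₀
      · subst hk; rw [phiForm_line_add, h, hkP]
      · rw [hother k hk, hotherP k hk]
    refine ⟨?_, Or.inr (by rw [h]; ring)⟩
    rw [hN, h]; ring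

/-- **THE JUMP OF AN `F`-WALL IS `0` OR `1`** (wall orientation, `torusN_floor_step`): at a separated simple crossing of a
form `k₀ ∈ F`, `J = 𝒩(θ_{s₀}) − 𝒩(θ_{s₀ − r/2}) ∈ {0, 1}`. -/
theorem jump_mem_of_FIdx {a : Dir} (hpos : ∀ k, 0 < h28 a k) {δ : Fin 8 → ℝ} {r : ℝ} (hr : 0 < r)
    {k₀ : Fin 28} {z₀ : ℤ} (hr1 : r * h28 a k₀ ≤ 1)
    (hsep : ∀ (k : Fin 28) (z : ℤ), k ≠ k₀ →
      r ≤ |((z₀ : ℝ) - phiForm δ k₀) / h28 a k₀ - ((z : ℝ) - phiForm δ k) / h28 a k|) (hF : k₀ ∈ FIdx) :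
    0 ≤ torusN ((((z₀ : ℝ) - phiForm δ k₀) / h28 a k₀) • sParam a + δ) -
        torusN ((((z₀ : ℝ) - phiForm δ k₀) / h28 a k₀ - r / 2) • sParam a + δ) ∧
      torusN ((((z₀ : ℝ) - phiForm δ k₀) / h28 a k₀) • sParam a + δ) -
        torusN ((((z₀ : ℝ) - phiForm δ k₀) / h28 a k₀ - r / 2) • sParam a + δ) ≤ 1 := by
  set s₀ := ((z₀ : ℝ) - phiForm δ k₀) / h28 a k₀ with hs₀def
  obtain ⟨hkP, hkM⟩ := floor_self_at_crossing hpos δ hr k₀ z₀ hr1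
  have h0 : ∀ k, |phiForm (0 : Fin 8 → ℝ) k| ≤ r * h28 a k / 4 := fun k => by
    have : phiForm (0 : Fin 8 → ℝ) k = 0 := by
      have h := phiForm_smul 0 (0 : Fin 8 → ℝ) k; rwa [zero_smul, zero_mul] at h
    rw [this, abs_zero]; have := hpos k; positivity
  have huP : |s₀ - s₀| ≤ r / 2 := by rw [sub_self, abs_zero]; positivity
  have huM : |s₀ - r / 2 - s₀| ≤ r / 2 := by
    rw [show s₀ - r / 2 - s₀ = -(r / 2) by ring, abs_neg, abs_of_pos (by positivity)]
  have hstep := torusN_floor_step (θ₁ := (s₀ - r / 2) • sParam a + δ) (θ₂ := s₀ • sParam a + δ) (k₀ := k₀)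
    (by rw [hkP, hkM]; ring) (fun k hk => by
      have h1 := floor_other_near_crossing hpos hr hsep huP h0 hk
      have h2 := floor_other_near_crossing hpos hr hsep huM h0 hk
      rw [add_zero] at h1 h2; rw [h1, h2])
  have h := hstep.1 hF
  constructor <;> linarith [h.1, h.2]

/-- **THE JUMP OF AN `F^c`-WALL IS `−1` OR `0`**: at a separated simple crossing of a form `k₀ ∉ F`,
`J = 𝒩(θ_{s₀}) − 𝒩(θ_{s₀ − r/2}) ∈ {−1, 0}`. -/
theorem jump_mem_of_not_FIdx {a : Dir} (hpos : ∀ k, 0 < h28 a k) {δ : Fin 8 → ℝ} {r : ℝ} (hr : 0 < r)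
    {k₀ : Fin 28} {z₀ : ℤ} (hr1 : r * h28 a k₀ ≤ 1)
    (hsep : ∀ (k : Fin 28) (z : ℤ), k ≠ k₀ →
      r ≤ |((z₀ : ℝ) - phiForm δ k₀) / h28 a k₀ - ((z : ℝ) - phiForm δ k) / h28 a k|) (hF : k₀ ∉ FIdx) :
    -1 ≤ torusN ((((z₀ : ℝ) - phiForm δ k₀) / h28 a k₀) • sParam a + δ) -
        torusN ((((z₀ : ℝ) - phiForm δ k₀) / h28 a k₀ - r / 2) • sParam a + δ) ∧
      torusN ((((z₀ : ℝ) - phiForm δ k₀) / h28 a k₀) • sParam a + δ) -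
        torusN ((((z₀ : ℝ) - phiForm δ k₀) / h28 a k₀ - r / 2) • sParam a + δ) ≤ 0 := by
  set s₀ := ((z₀ : ℝ) - phiForm δ k₀) / h28 a k₀ with hs₀def
  obtain ⟨hkP, hkM⟩ := floor_self_at_crossing hpos δ hr k₀ z₀ hr1
  have h0 : ∀ k, |phiForm (0 : Fin 8 → ℝ) k| ≤ r * h28 a k / 4 := fun k => by
    have : phiForm (0 : Fin 8 → ℝ) k = 0 := by
      have h := phiForm_smul 0 (0 : Fin 8 → ℝ) k; rwa [zero_smul, zero_mul] at h
    rw [this, abs_zero]; have := hpos k; positivity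
  have huP : |s₀ - s₀| ≤ r / 2 := by rw [sub_self, abs_zero]; positivity
  have huM : |s₀ - r / 2 - s₀| ≤ r / 2 := by
    rw [show s₀ - r / 2 - s₀ = -(r / 2) by ring, abs_neg, abs_of_pos (by positivity)]
  have hstep := torusN_floor_step (θ₁ := (s₀ - r / 2) • sParam a + δ) (θ₂ := s₀ • sParam a + δ) (k₀ := k₀)
    (by rw [hkP, hkM]; ring) (fun k hk => by
      have h1 := floor_other_near_crossing hpos hr hsep huP h0 hk
      have h2 := floor_other_near_crossing hpos hr hsep huM h0 hk
      rw [add_zero] at h1 h2; rw [h1, h2])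
  have h := hstep.2 hF
  constructor <;> linarith [h.1, h.2]

/-- **THE RESPONSE ON THE WINDOW**: under the hypotheses of `torusN_near_crossing`, for `|u − s₀| ≤ r/2` and
`|φ_k Δ| ≤ r·h_k/4`: `𝒩(u·s(a) + δ + Δ) − 𝒩(u·s(a) + δ) = J·(⌊y + φ_{k₀}Δ⌋ − ⌊y⌋)`, `y = u·h_{k₀}(a) + φ_{k₀}δ` — the
displaced crossing sweeps the jump `J` over the stretch between the old and the new crossing time. -/
theorem torusN_sub_near_crossing {a : Dir} (hpos : ∀ k, 0 < h28 a k) {δ : Fin 8 → ℝ} {r : ℝ} (hr : 0 < r)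
    {k₀ : Fin 28} {z₀ : ℤ} (hr1 : r * h28 a k₀ ≤ 1)
    (hsep : ∀ (k : Fin 28) (z : ℤ), k ≠ k₀ →
      r ≤ |((z₀ : ℝ) - phiForm δ k₀) / h28 a k₀ - ((z : ℝ) - phiForm δ k) / h28 a k|)
    {u : ℝ} (hu : |u - ((z₀ : ℝ) - phiForm δ k₀) / h28 a k₀| ≤ r / 2)
    {Δ : Fin 8 → ℝ} (hΔ : ∀ k, |phiForm Δ k| ≤ r * h28 a k / 4) :
    ((torusN (u • sParam a + δ + Δ) : ℤ) : ℝ) - torusN (u • sParam a + δ) =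
      (torusN ((((z₀ : ℝ) - phiForm δ k₀) / h28 a k₀) • sParam a + δ) -
          torusN ((((z₀ : ℝ) - phiForm δ k₀) / h28 a k₀ - r / 2) • sParam a + δ) : ℤ) *
        ((⌊u * h28 a k₀ + phiForm δ k₀ + phiForm Δ k₀⌋ : ℝ) - ⌊u * h28 a k₀ + phiForm δ k₀⌋) := by
  have h0 : ∀ k, |phiForm (0 : Fin 8 → ℝ) k| ≤ r * h28 a k / 4 := fun k => by
    have : phiForm (0 : Fin 8 → ℝ) k = 0 := by
      have h := phiForm_smul 0 (0 : Fin 8 → ℝ) k; rwa [zero_smul, zero_mul] at h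
    rw [this, abs_zero]; have := hpos k; positivity
  have h1 := (torusN_near_crossing hpos hr hr1 hsep hu hΔ).1
  have h2 := (torusN_near_crossing hpos hr hr1 hsep hu h0).1
  have hz : phiForm (0 : Fin 8 → ℝ) k₀ = 0 := by
    have h := phiForm_smul 0 (0 : Fin 8 → ℝ) k₀; rwa [zero_smul, zero_mul] at h
  rw [add_zero, hz, add_zero] at h2
  have e : ((torusN (u • sParam a + δ + Δ) : ℤ) : ℝ) - torusN (u • sParam a + δ) =
      (((torusN (u • sParam a + δ + Δ) - torusN (u • sParam a + δ) : ℤ)) : ℝ) := by push_cast; ring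
  rw [e, h1, h2]
  push_cast
  ring

/-- **NO RESPONSE AWAY FROM THE CROSSINGS**: if `u` is at distance `≥ r/2` from EVERY crossing time of every form, then
`𝒩(u·s(a) + δ + Δ) = 𝒩(u·s(a) + δ)` for `|φ_k Δ| ≤ r·h_k/4` (every form of `θ_u` is `≥ r·h_k/2 > |φ_k Δ|` from `ℤ`). -/
theorem torusN_add_eq_of_far {a : Dir} (hpos : ∀ k, 0 < h28 a k) {δ : Fin 8 → ℝ} {r : ℝ} (hr : 0 < r)
    {u : ℝ} (hfar : ∀ (k : Fin 28) (z : ℤ), r / 2 ≤ |u - ((z : ℝ) - phiForm δ k) / h28 a k|)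
    {Δ : Fin 8 → ℝ} (hΔ : ∀ k, |phiForm Δ k| ≤ r * h28 a k / 4) :
    torusN (u • sParam a + δ + Δ) = torusN (u • sParam a + δ) := by
  refine torusN_add_eq_of_forms_far fun k z => ?_
  have hx := hpos k
  rw [phiForm_line]
  have h := mul_le_mul_of_nonneg_right (hfar k z) hx.le
  rw [← abs_of_pos hx, ← abs_mul, abs_of_pos hx] at h
  have e : (u - ((z : ℝ) - phiForm δ k) / h28 a k) * h28 a k = u * h28 a k + phiForm δ k - z := by
    field_simp; ring
  rw [e] at h
  calc |phiForm Δ k| ≤ r * h28 a k / 4 := hΔ k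
    _ < r / 2 * h28 a k := by nlinarith
    _ ≤ _ := h

/-! ### The exact window integral of one displaced floor -/

/-- `y ↦ ⌊y + e⌋` is interval integrable (monotone). -/
theorem intervalIntegrable_floor_add (e α β : ℝ) : IntervalIntegrable (fun y : ℝ => (⌊y + e⌋ : ℝ)) volume α β :=
  Monotone.intervalIntegrable fun _ _ h => by exact_mod_cast Int.floor_le_floor (by linarith)

/-- **Window integral, normalised**: for `z ∈ ℤ`, `ρ ≤ 1/2` and `|e| < ρ`:
`∫_{z−ρ}^{z+ρ} (⌊y + e⌋ − ⌊y⌋) dy = e`. -/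
theorem integral_floor_shift_window (z : ℤ) {ρ e : ℝ} (hρ1 : ρ ≤ 1 / 2) (he : |e| < ρ) :
    ∫ y in ((z : ℝ) - ρ)..((z : ℝ) + ρ), ((⌊y + e⌋ : ℝ) - ⌊y⌋) = e := by
  have hfl := intervalIntegrable_floor
  have he' := abs_lt.mp he
  rw [intervalIntegral.integral_sub (intervalIntegrable_floor_add e _ _) (hfl _ _),
    intervalIntegral.integral_comp_add_right (fun y : ℝ => (⌊y⌋ : ℝ)) e,
    intervalIntegral.integral_interval_sub_interval_comm' (hfl _ _) (hfl _ _) (hfl _ _)]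
  -- right piece: floor `= z`
  have hR : ∫ y in ((z : ℝ) + ρ)..((z : ℝ) + ρ + e), (⌊y⌋ : ℝ) = e * z := by
    rw [intervalIntegral.integral_congr (g := fun _ => (z : ℝ)) (fun y hy => by
      have h : (z : ℝ) + ρ - |e| ≤ y ∧ y ≤ (z : ℝ) + ρ + |e| := by
        rcases Set.mem_uIcc.mp hy with ⟨h1, h2⟩ | ⟨h1, h2⟩ <;>
          constructor <;> linarith [le_abs_self e, neg_abs_le e]
      have : ⌊y⌋ = z := Int.floor_eq_iff.mpr ⟨by linarith [abs_nonneg e], by linarith⟩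
      simp [this]), intervalIntegral.integral_const, smul_eq_mul]
    ring
  -- left piece: floor `= z - 1`
  have hL : ∫ y in ((z : ℝ) - ρ)..((z : ℝ) - ρ + e), (⌊y⌋ : ℝ) = e * (z - 1) := by
    rw [intervalIntegral.integral_congr (g := fun _ => ((z : ℝ) - 1)) (fun y hy => by
      have h : (z : ℝ) - ρ - |e| ≤ y ∧ y ≤ (z : ℝ) - ρ + |e| := by
        rcases Set.mem_uIcc.mp hy with ⟨h1, h2⟩ | ⟨h1, h2⟩ <;>
          constructor <;> linarith [le_abs_self e, neg_abs_le e]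
      have : ⌊y⌋ = z - 1 := Int.floor_eq_iff.mpr ⟨by push_cast; linarith, by push_cast; linarith⟩
      simp [this]), intervalIntegral.integral_const, smul_eq_mul]
    ring
  rw [hR, hL]
  ring

/-- **THE EXACT WINDOW INTEGRAL OF A DISPLACED CROSSING.** For `x > 0`, a crossing time `s₀` (`s₀·x + c ∈ ℤ`), a
half-width `ρ` with `ρ·x ≤ 1/2` and a displacement `|e| < ρ·x` of the form value:
`∫_{s₀−ρ}^{s₀+ρ} (⌊u·x + c + e⌋ − ⌊u·x + c⌋) du = e/x` — the crossing moves by `e/x` in time. -/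
theorem integral_floor_line_shift_window {x c s₀ : ℝ} {z : ℤ} (hx : 0 < x) (hs₀ : s₀ * x + c = z) {ρ e : ℝ}
    (hρx : ρ * x ≤ 1 / 2) (he : |e| < ρ * x) :
    ∫ u in (s₀ - ρ)..(s₀ + ρ), ((⌊u * x + c + e⌋ : ℝ) - ⌊u * x + c⌋) = e / x := by
  have h := intervalIntegral.integral_comp_mul_add (a := s₀ - ρ) (b := s₀ + ρ)
    (fun y : ℝ => (⌊y + e⌋ : ℝ) - ⌊y⌋) hx.ne' c
  simp only [smul_eq_mul] at h
  rw [show x * (s₀ - ρ) + c = (z : ℝ) - ρ * x by rw [← hs₀]; ring,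
    show x * (s₀ + ρ) + c = (z : ℝ) + ρ * x by rw [← hs₀]; ring,
    integral_floor_shift_window z hρx he] at h
  rw [← div_eq_inv_mul] at h
  rw [← h]
  refine intervalIntegral.integral_congr fun u _ => ?_
  simp only [mul_comm x u]

end Summit.KontsevichZagierPeriods.Zeta5Search.Barrier.ConeGamma

end
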